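import Literature.AnabelianGeometry.SemiGraphs.TemperoidsProductLayer
import Mathlib.CategoryTheory.Limits.Shapes.FiniteProducts
import Mathlib.CategoryTheory.Limits.Shapes.FiniteLimits
import Literature.AlgebraicGeometry.Frobenioids.CoproductCompletionConnected
import HarnessLib

/-!
# Semi-graphs of anabelioids, §3, Remark 3.1.5 — product layer (2): `∏ᵢ Cᵢ` is of countably
# connected type when the factors are

Mochizuki, *Semi-graphs of anabelioids*, Publ. RIMS **42** (2006), §3, Remark 3.1.5 (manuscript
p. 34) [cite: MochizukiSemiAnbd2006, Rmk 3.1.5 p.34]: "every temperoid is an almost totally epimorphic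
category of countably connected type".  Continuing `TemperoidsProductLayer.lean`: for a COUNTABLE
family of categories `Cᵢ` of countably connected type ([FrdI] §0 p. 15) whose initial objects are
strict, the product `∏ᵢ Cᵢ` (Mathlib `CategoryTheory.pi`) is of countably connected type — every
object is the countable coproduct, over `Σ i, ιᵢ`, of the connected summands of its coordinates placed
in one coordinate (initial elsewhere), and a connected object (one connected coordinate `i₀`) sees a
countable coproduct through its `i₀`-th coordinate.  Evaluation at a coordinate preserves the
relevant colimit cofans because coordinatewise coproducts exist.  Proof-only apart from
`IsColimit`/`Equiv` data; nothing is specific to temperoids; nothing takes a side on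
[IUTchIII] Cor. 3.12.
-/

namespace Literature.AnabelianGeometry.SemiGraphs

namespace TemperoidProduct

open CategoryTheory CategoryTheory.Limits
open Literature.AlgebraicGeometry.Frobenioids

universe w w' v₁ u₁

variable {I : Type w} {C : I → Type u₁} [∀ i, Category.{v₁} (C i)]

/-! ### Evaluation at a coordinate preserves coproduct cofans -/

/-- Evaluation at `i` of a colimit cofan of `∏ᵢ Cᵢ` is a colimit cofan of `Cᵢ` (the factors having
coproducts of that shape). [folklore] -/
noncomputable def isColimitCofanEval {K : Type w'} [∀ i, HasCoproductsOfShape K (C i)]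
    {X : K → ∀ i, C i} (c : Cofan X) (hc : IsColimit c) (i : I) :
    IsColimit (Cofan.mk (c.pt i) fun k => c.inj k i) := by
  let d : ∀ j, Cofan (fun k => X k j) := fun j => colimit.cocone (Discrete.functor fun k => X k j)
  have hd : ∀ j, IsColimit (d j) := fun j => colimit.isColimit _
  let φ : c.pt ≅ (cofanPi X d).pt := hc.coconePointUniqueUpToIso (isColimitCofanPi X d hd)
  refine (hd i).ofIsoColimit (Cocone.ext (Pi.isoApp φ i).symm ?_)
  rintro ⟨k⟩
  exact congrFun (hc.comp_coconePointUniqueUpToIso_inv (isColimitCofanPi X d hd) ⟨k⟩) i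

/-- Evaluation at `i` of a colimit binary cofan of `∏ᵢ Cᵢ` is a colimit binary cofan of `Cᵢ` (the
factors having binary coproducts). [folklore] -/
noncomputable def isColimitBinaryCofanEval [∀ i, HasBinaryCoproducts (C i)] {A B₁ B₂ : ∀ i, C i}
    (ι₁ : B₁ ⟶ A) (ι₂ : B₂ ⟶ A) (hc : IsColimit (BinaryCofan.mk ι₁ ι₂)) (i : I) :
    IsColimit (BinaryCofan.mk (ι₁ i) (ι₂ i)) := by
  let d : ∀ j, BinaryCofan (B₁ j) (B₂ j) := fun j =>
    BinaryCofan.mk (coprod.inl : B₁ j ⟶ B₁ j ⨿ B₂ j) coprod.inr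
  have hd : ∀ j, IsColimit (d j) := fun j => coprodIsCoprod (B₁ j) (B₂ j)
  have hc' : IsColimit (BinaryCofan.mk (fun j => (coprod.inl : B₁ j ⟶ B₁ j ⨿ B₂ j) :
      B₁ ⟶ fun j => B₁ j ⨿ B₂ j) (fun j => coprod.inr)) :=
    isColimitBinaryCofanPi _ _ hd
  let φ : A ≅ (fun j => B₁ j ⨿ B₂ j) := hc.coconePointUniqueUpToIso hc'
  refine (hd i).ofIsoColimit (Cocone.ext (Pi.isoApp φ i).symm ?_)
  rintro ⟨_ | _⟩
  · exact congrFun (hc.comp_coconePointUniqueUpToIso_inv hc' ⟨WalkingPair.left⟩) i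
  · exact congrFun (hc.comp_coconePointUniqueUpToIso_inv hc' ⟨WalkingPair.right⟩) i

/-! ### Connected objects: the converse, and `Hom` out of a connected object -/

section Initial

variable [∀ i, HasInitial (C i)]

/-- An object of `∏ᵢ Cᵢ` with one connected coordinate and all other coordinates initial is connected
(factors with strict initial objects and binary coproducts). [cite: MochizukiSemiAnbd2006, Rmk 3.1.5 p.34] -/
theorem isConnectedObj_of_apply [∀ i, HasBinaryCoproducts (C i)]
    (hstrict : ∀ i {A B : C i} (_ : A ⟶ B), IsNonemptyObj A → IsNonemptyObj B)
    {B : ∀ i, C i} (i₀ : I) (h₀ : IsConnectedObj (B i₀))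
    (hrest : ∀ j, j ≠ i₀ → ¬ IsNonemptyObj (B j)) : IsConnectedObj B := by
  refine ⟨isNonemptyObj_of_apply i₀ h₀.1, fun B₁ B₂ ι₁ ι₂ hB₁ hB₂ => ⟨fun hc => ?_⟩⟩
  have key : ∀ {B' : ∀ i, C i} (_ : B' ⟶ B), IsNonemptyObj B' → IsNonemptyObj (B' i₀) :=
    fun {B'} ι' hB' => by
      obtain ⟨j, hj⟩ := exists_isNonemptyObj_apply hB'
      by_cases hji : j = i₀
      · exact hji ▸ hj
      · exact absurd (hstrict j (ι' j) hj) (hrest j hji)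
  exact (h₀.2 _ _ (ι₁ i₀) (ι₂ i₀) (key ι₁ hB₁) (key ι₂ hB₂)).false
    (isColimitBinaryCofanEval ι₁ ι₂ hc i₀)

/-- Morphisms out of an object of `∏ᵢ Cᵢ` whose coordinates off `i₀` are initial are determined by,
and freely given by, their `i₀`-th coordinate. [folklore] -/
noncomputable def homEquivEval (B Y : ∀ i, C i) (i₀ : I)
    (hrest : ∀ j, j ≠ i₀ → ¬ IsNonemptyObj (B j)) : (B ⟶ Y) ≃ (B i₀ ⟶ Y i₀) := by
  classical
  exact
    { toFun := fun f => f i₀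
      invFun := fun g i => if h : i = i₀ then h ▸ g
        else (nonempty_isInitial_of_not_isNonemptyObj (hrest i h)).some.to (Y i)
      left_inv := fun f => by
        ext i
        by_cases h : i = i₀
        · subst h; simp
        · simp only [dif_neg h]
          exact (nonempty_isInitial_of_not_isNonemptyObj (hrest i h)).some.hom_ext _ _
      right_inv := fun g => by simp }

/-- **Connected objects see countable coproducts coordinatewise**: for a colimit cofan of `∏ᵢ Cᵢ`
over `K` and a connected `B` (one connected coordinate `i₀`), `Σₖ Hom(B, Xₖ) → Hom(B, ∐ Xₖ)` is the
corresponding map for the `i₀`-th coordinates, hence bijective when it is so in `C_{i₀}`.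
[cite: MochizukiSemiAnbd2006, Rmk 3.1.5 p.34] -/
theorem bijective_pi [∀ i, HasBinaryCoproducts (C i)] {K : Type w'}
    [∀ i, HasCoproductsOfShape K (C i)]
    (hbij : ∀ i {X : K → C i} (c : Cofan X), IsColimit c → ∀ B : C i, IsConnectedObj B →
      Function.Bijective fun p : Σ k, (B ⟶ X k) => p.2 ≫ c.inj p.1)
    {X : K → ∀ i, C i} (c : Cofan X) (hc : IsColimit c) (B : ∀ i, C i) (hB : IsConnectedObj B) :
    Function.Bijective fun p : Σ k, (B ⟶ X k) => p.2 ≫ c.inj p.1 := by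
  obtain ⟨i₀, hBi₀, hrest⟩ := isConnectedObj_apply hB
  have hD := hbij i₀ (Cofan.mk (c.pt i₀) fun k => c.inj k i₀) (isColimitCofanEval c hc i₀) (B i₀) hBi₀
  let ε : (B ⟶ c.pt) ≃ (B i₀ ⟶ c.pt i₀) := homEquivEval B c.pt i₀ hrest
  let σ : (Σ k, (B ⟶ X k)) ≃ (Σ k, (B i₀ ⟶ X k i₀)) :=
    Equiv.sigmaCongrRight fun k => homEquivEval B (X k) i₀ hrest
  have hcomp : (fun p : Σ k, (B ⟶ X k) => p.2 ≫ c.inj p.1) =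
      ε.symm ∘ (fun q : Σ k, (B i₀ ⟶ X k i₀) =>
        q.2 ≫ (Cofan.mk (c.pt i₀) fun k => c.inj k i₀).inj q.1) ∘ σ := by
    funext p
    apply ε.injective
    simp only [Function.comp_apply, Equiv.apply_symm_apply]
    rfl
  rw [hcomp]
  exact ε.symm.bijective.comp (hD.comp σ.bijective)

end Initial


/-! ### Every object of `∏ᵢ Cᵢ` is a countable coproduct of connected objects -/

section Decomposition

/-- A summand over `P`: an object with a structure map to `P` (bookkeeping for the coordinatewise
summands in the verification of [SemiAnbd] Rmk. 3.1.5). [cite: MochizukiSemiAnbd2006, Rmk 3.1.5 p.34] -/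
structure Summand {E : Type u₁} [Category.{v₁} E] (P : E) where
  /-- the summand -/
  X : E
  /-- its structure map -/
  leg : X ⟶ P

/-- Transport of the structure map along an equality of summands (step of the verification of
[SemiAnbd] Rmk. 3.1.5). [cite: MochizukiSemiAnbd2006, Rmk 3.1.5 p.34] -/
theorem Summand.leg_eq_of_eq {E : Type u₁} [Category.{v₁} E] {P : E} {s s' : Summand P}
    (h : s = s') : s.leg = eqToHom (congrArg Summand.X h) ≫ s'.leg := by
  subst h
  simp

/-- Extension of a colimit cofan by initial summands is a colimit cofan: legs `leg κ : obj κ ⟶ c.pt`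
that restrict along `emb : ι → K` (up to given isomorphisms) to the injections of a colimit cofan `c`
and whose other domains are initial form a colimit cofan. [folklore] -/
noncomputable def isColimitExtendByInitial {E : Type u₁} [Category.{v₁} E] {ι : Type w'}
    {K : Type w'} {X : ι → E} (c : Cofan X) (hc : IsColimit c) {obj : K → E}
    (leg : ∀ κ, obj κ ⟶ c.pt) (emb : ι → K) (φ : ∀ k, X k ≅ obj (emb k))
    (hφ : ∀ k, (φ k).hom ≫ leg (emb k) = c.inj k)
    (hinit : ∀ κ, (∀ k, emb k ≠ κ) → IsInitial (obj κ)) :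
    IsColimit (Cofan.mk c.pt leg) := by
  classical
  let res : ∀ t : Cofan obj, Cofan X := fun t =>
    Cofan.mk t.pt fun k => (φ k).hom ≫ t.inj (emb k)
  refine Cofan.IsColimit.mk _ (fun t => hc.desc (res t)) (fun t κ => ?_) (fun t m hm => ?_)
  · change leg κ ≫ hc.desc (res t) = t.inj κ
    by_cases hκ : ∃ k, emb k = κ
    · obtain ⟨k, rfl⟩ := hκ
      have h2 : c.inj k ≫ hc.desc (res t) = (φ k).hom ≫ t.inj (emb k) := hc.fac (res t) ⟨k⟩
      rw [← hφ k, Category.assoc] at h2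
      exact (cancel_epi (φ k).hom).mp h2
    · push Not at hκ
      exact (hinit κ hκ).hom_ext _ _
  · refine hc.uniq (res t) m fun ⟨k⟩ => ?_
    change c.inj k ≫ m = (φ k).hom ≫ t.inj (emb k)
    have h1 : leg (emb k) ≫ m = t.inj (emb k) := hm (emb k)
    rw [← hφ k, Category.assoc, h1]

/-- **Every object of `∏ᵢ Cᵢ` is a countable coproduct of connected objects** (countable index
family; factors of countably connected type with strict initial objects): the summands are the
connected summands of the coordinates, each placed in its own coordinate and initial elsewhere.
[cite: MochizukiSemiAnbd2006, Rmk 3.1.5 p.34] -/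
theorem exists_cofan_pi {I : Type} {C : I → Type u₁} [∀ i, Category.{v₁} (C i)]
    [∀ i, HasInitial (C i)] [Countable I] [∀ i, HasBinaryCoproducts (C i)]
    (hstrict : ∀ i {A B : C i} (_ : A ⟶ B), IsNonemptyObj A → IsNonemptyObj B)
    (h : ∀ i, IsOfCountablyConnectedType (C i)) (A : ∀ i, C i) :
    ∃ (K : Type) (_ : Countable K) (E : K → ∀ i, C i), (∀ κ, IsConnectedObj (E κ)) ∧
      ∃ c : Cofan E, Nonempty (IsColimit c) ∧ Nonempty (c.pt ≅ A) := by
  classical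
  choose ι hι X hX c hc e using fun i => (h i).exists_cofan (A i)
  let S : ∀ j, (Σ i, ι i) → Summand (c j).pt := fun j κ =>
    if hκ : κ.1 = j then hκ ▸ (⟨X κ.1 κ.2, (c κ.1).inj κ.2⟩ : Summand (c κ.1).pt)
    else ⟨⊥_ (C j), initial.to _⟩
  have hS : ∀ j (k : ι j), S j ⟨j, k⟩ = ⟨X j k, (c j).inj k⟩ := fun j k => by
    simp [S]
  have hS' : ∀ j (κ : Σ i, ι i), κ.1 ≠ j → S j κ = ⟨⊥_ (C j), initial.to _⟩ := fun j κ hκ => by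
    simp [S, hκ]
  have hinit : ∀ j (κ : Σ i, ι i), κ.1 ≠ j → Nonempty (IsInitial (S j κ).X) := fun j κ hκ =>
    ⟨initialIsInitial.ofIso (eqToIso (congrArg Summand.X (hS' j κ hκ)).symm)⟩
  let E : (Σ i, ι i) → ∀ j, C j := fun κ j => (S j κ).X
  haveI : ∀ i, Countable (ι i) := hι
  let d : ∀ j, Cofan fun κ => E κ j := fun j => Cofan.mk (c j).pt fun κ => (S j κ).leg
  refine ⟨Σ i, ι i, inferInstance, E, fun κ => ?_, ⟨cofanPi E d, ⟨isColimitCofanPi E d fun j => ?_⟩,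
    ⟨?_⟩⟩⟩
  rotate_left 2
  · change (fun j => (c j).pt) ≅ A
    exact Pi.isoMk fun j => (e j).some
  · -- `E ⟨i, k⟩` is `X i k` at `i` and initial elsewhere, hence connected
    obtain ⟨i, k⟩ := κ
    refine isConnectedObj_of_apply hstrict i ?_ fun j hj => ?_
    · change IsConnectedObj (S i ⟨i, k⟩).X
      exact IsConnectedObj.of_iso (hX i k) (eqToIso (congrArg Summand.X (hS i k)).symm)
    · change ¬ IsNonemptyObj (S j ⟨i, k⟩).X
      exact fun hne => hne.false (hinit j ⟨i, k⟩ (Ne.symm hj)).some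
  · -- coordinate `j`: extension of `c j` by initial summands
    refine isColimitExtendByInitial (c j) (hc j).some (fun κ => (S j κ).leg)
      (fun k => (⟨j, k⟩ : Σ i, ι i)) (fun k => eqToIso (congrArg Summand.X (hS j k)).symm)
      (fun k => ?_) fun κ hκ => (hinit j κ fun hj => ?_).some
    · rw [Summand.leg_eq_of_eq (hS j k)]
      simp
    · obtain ⟨i, k⟩ := κ
      change i = j at hj
      subst hj
      exact hκ k rfl

/-- **A countable product of categories of countably connected type with strict initial objects is
of countably connected type.** [cite: MochizukiSemiAnbd2006, Rmk 3.1.5 p.34] -/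
theorem isOfCountablyConnectedType_pi {I : Type} {C : I → Type u₁} [∀ i, Category.{v₁} (C i)]
    [Countable I]
    (hstrict : ∀ i {A B : C i} (_ : A ⟶ B), IsNonemptyObj A → IsNonemptyObj B)
    (h : ∀ i, IsOfCountablyConnectedType (C i)) : IsOfCountablyConnectedType (∀ i, C i) := by
  haveI : ∀ i, HasCountableCoproducts (C i) := fun i => (h i).hasCountableCoproducts
  haveI : ∀ i, HasBinaryCoproducts (C i) := fun i => inferInstance
  haveI : ∀ i, HasInitial (C i) := fun i => inferInstance
  exact
    { hasCountableCoproducts := hasCountableCoproducts_pi fun i => (h i).hasCountableCoproducts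
      exists_cofan := exists_cofan_pi hstrict h
      bijective := fun {K} _ {X} c hc B hB => by
        haveI : ∀ i, HasCoproductsOfShape K (C i) := fun i => HasCountableCoproducts.out K
        exact bijective_pi (fun i X c hc B hB => (h i).bijective c hc B hB) c hc B hB }

end Decomposition

end TemperoidProduct

end Literature.AnabelianGeometry.SemiGraphs
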